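import Summits.HodgeConjecture.HodgeConjecture.Theorems.R90S9DefiniteAeRigidityOfLevels      -- ★ p862550 (this seat, (δ1)): `definiteAeRigidity_ofLevels` — (α) with §14.6 at `Γ₀` from the abstract guarded level datum
import Summits.HodgeConjecture.HodgeConjecture.Theorems.R90S9Sec146LevelPins               -- ★ p862607 (R90-IF-p04 (g2)): THE CONCRETE LEVEL DATUM (`Level`, `IsLevelTest`, `Evp`, `HeckeOff`, `evOff`, `EvpSupport`, `gradeRep`, `gradePacket(H)`, `twistTest`, ★ p862556) + its six pins
import Summits.HodgeConjecture.HodgeConjecture.Theorems.R90S9PisSlotsNotSphericalOfRecordSCD -- ★ p862577 (this seat, (δ4)): `pisSlotsNotSphericalCofinite_recordSCD` — the law «`πˢ(ξ_v)` ramified a.e.» PAID for the record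
import HarnessLib

/-!
# R90-TF · S9 «InnerForm-13.3.6 (c)» — (δ5) `definiteAeRigidity_ofLevelPins`: (δ1) AT R90-IF-p04's CONCRETE LEVEL DATUM (`Λ := Level`, `𝓕 := IsLevelTest`, …) with
# its six definitional pins and the law «`πˢ(ξ_v)` ramified a.e.» discharged — the B ED. 4 pay-line name over named letters
# (Rogawski 1990 §14.5 Thm. 14.5.1 (b) p. 238; §14.6 Thm. 14.6.1 p. 241, p. 242, Thm. 14.6.4 p. 244; §13.3 Thm. 13.3.5 p. 202)

Cell `hodgecm-mathlib`, crux H413 (`stmt-HodgeConjecture-24833`, lane `--supports … --as helper`), route of record `HCCMUnconditional` (no route verbs; count-neutral).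
Programme R90-TF (brief `director/R90-BRIEF.v2.md` 1f40d54518340a35), section S9 = InnerForm-13.3.6 (c) (base `R90-IF`); seat R90-IF-p06 (g0).  DEALT BY NAME: R90-IF-plan
(g0) DEAL MAP 2026-09-04T16:51:37Z (4) «p06 = (α) `Theorems/R90S9DefiniteAeRigidityOfDatum.lean` (instantiate ★ p862161 at Γ₀; discharge hm∕hread∕hevp∕hD; leaves EXACTLY the
law binders)», then 22:27:28Z «GO (δ1) `Theorems/R90S9DefiniteAeRigidityOfLevels.lean` = (α) ∘ p04 (g2)'s `sec146_of_levels′` at `gammaSph … X` … so B ED. 4's pay line is ONE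
Theorems name over NAMED letters + law sockets».  THIS FILE = ★ (δ1) `definiteAeRigidity_ofLevels` (p862550) AT THE CONCRETE
LEVEL DATUM of ★ `R90S9InnerFormSec146Levels` ∕ ★ `R90S9Sec146LevelPins` (R90-IF-p04 (g2), deal (b)): `TG′ :=` the PAIR test type of ★ p862002 (S9-R-TG), `Λ := Level L`,
`𝓕 := IsLevelTest L ι H T hT`, `E := Evp L H`, `Hk := HeckeOff L H`, `ev := evOff L H μv`, `U := EvpSupport L H μv`, `tR := gradeRep …`, `tP := gradePacket … X`, `tH :=
gradePacketH … X`, `tw′ := twistTest L H μv`, the six definitional pins DISCHARGED exactly as in p04's ★ certificate `hsep_gammaSph_of_levelPins` (`hUR hUP hUH` ★ §2, `h𝓕tw` ★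
`isLevelTest_twistTest`, `hliftEx` ★ `exists_gradePacket_of_gradePacketH`, `hgerm` ★ `evpRep_gammaSph_of_grade_eq`), and the datum law `hPis` DISCHARGED by ★ (δ4)
`pisSlotsNotSphericalCofinite_recordSCD`.  REMAINING BINDERS beyond (α)'s: local Haar measures `μv` (`hμ`), `hχ𝓕` (χ-expansion on level tests — R90-IF-p05's ★ J10
`chiExpansion_gammaSph_of_allClasses_levels` pays it from the all-classes law), the consumer's twists `tw twH` with `hTw hTHw` (fundamental lemma for Hecke twists, S3∕S6),
`hER hEP hEH` (eigen-laws, S7), `hsepL` (Langlands' lemma, E1∕S10), `hcoverR` (graded level + guarded detector, S3∕S6), `hgermLevel` (cofinality, S1∕S4∕S5), `htP` (e.v.p.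
rigidity of `Π(G)` [13.3.5], S5∕S7), `hDisj` («in at most one» for the A-packets of record, S3∕S4), `htri` (Thm. 13.3.5 trichotomy, S5), `hApkt` (`Π_a(G) = {Π(ξ)}`, S5), `hmn`
((MN), S2), `hcoeffMem` ((CMP), R90-IF-p03 (g2)'s ★ `hcoeffMem_gammaSph_tupleOf` per `(Π(ξ), ξ)` modulo its named letters).
THEOREMS ONLY (no `def`, no instance, no notation, no named-fact hypothesis, no `sorry`); imports ★ `Theorems` only (FILE B ED. 4 may import THIS file).
HONEST LABEL: HC_CM is proved only modulo the 7 printed citations (2 remaining named inputs: hLiu418 = stmt-HodgeConjecture-24832, h413 = stmt-HodgeConjecture-24833) — until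
rung 0 closes.  This file proves NOTHING printed about the §14.6 comparison: it is the PAY-LINE SHAPE of FILE B ED. 4's on-path socket `SocketDefiniteAeRigidityFramedKit`
(S9-R-K (2)) — the (AE-ⅱ) organ «e.v.p. ⟹ Π′(ξ)-membership for the definite inner form» AT THE DATUM OF RECORD, with every DATUM-SIDE pin of the engine discharged in the
kernel and EXACTLY the law binders left, each a fixed Prop over the consumer's `X` (the junction sub-sockets of B ED. 4): (S6) `h51k` = Thm. 14.5.1 (b) in the S6-B KIT SHAPE
(J5: `sock_S9_thm1451b_cm`, payer S6-A `traceGp_eq_sjTot_pinned`; SEAM 8 currying done HERE: `Transfer₀ := fun f′ f => Smooth f′ ∧ Transfer f′ f`, (m1)); (S5∕S8) `h62 h38 hexH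
hH61 hvan hvanH` = the ★ `GlobalPacketData` discrete expansions + vanishing classes at `X.G ∕ X.tr ∕ X.trH` (J8); (S7∕S9) `h64` = §14.6 at `Γ₀^{sph}` (p07's ★ `sec146_of_parts_mem`
at the datum: `sock_S9_sec146_cm`); (S5) `Pξ, hA` = «`Π(ξ) ∈ Π_a(G)`» for the packet of record; (S5, J9) `hevpXi` = «`t(Π′(ξ)) = t(Π(ξ))`» read at the kit (`sock_S9_evpXi_cm`).
DISCHARGED HERE (no binder): `π′ := classOfSph P hsph`, `hm` (★ `gammaSph_m'_ne_zero`, anisotropic `H`), `hD` (★ `gammaSph_dSplit`), `hstring` (★ `aeString_of_ae`), `hevp`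
(★ α2 `evpRep_of_ae_of_evp_piXiPrime` + `rfl` read-back), `hback` (★ α1 `sgTail_of_ae_of_recordSCD` + ★ `gammaSph_mem'_piXi'_classOfSph`), at the A-PACKET FAMILY OF RECORD
`Ξ₀ := xiPacketFamilyOfRecordSCD … μZ keys (hSCD_of_cmCharIdentityPackageTestSigned … μZ hQS)` (★ F0P3; the record's V6 data `μZ keys` are binders — B fixes the rung-0 Borel
Haar family and Keys data, ★ `exists_isHaarMeasure_gqs_quotient_center` ∕ ★ `exists_keysData_of_keysCaseTwo`).  Scope: FRAMED `H` (`ι T hT`) and `P` `K_c`-spherical (`hsph`,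
S9-R-Kc) — the classes `Γ₀^{sph}` carries.  Conclusion = the (S-G) tail of ★ `definiteXiMembership_of_ch14`'s `hRig` for `ξ`, BYTE FOR BYTE.
Proof: ★ `definiteAeRigidityAt_of_parts'` at `Γ := gammaSph … X`, `Transfer := Transfer₀`, the five discharges above.  Axioms TRIO.

[cite: Rogawski1990, §14.5 Thm. 14.5.1 (b) p. 238; §14.6 Thm. 14.6.1 (14.6.1) p. 241, p. 242, Thm. 14.6.4 p. 244; §13.3 Thm. 13.3.5 p. 202, p. 201; §13.6 pp. 208–210; §13.1 Prop. 13.1.3 (d), Prop. 13.1.4 p. 199; §12.2 (2) p. 174; §14.2 p. 233]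
[cite: FlathCorvallis1979, Thm. 3] [cite: CartierCorvallis1979, §IV.1 Cor. 4.1]
-/

set_option autoImplicit false
-- the mandated namespace repeats `HodgeConjecture.HodgeConjecture`, as in every `Theorems/*.lean` of this sub-problem
set_option linter.dupNamespace false

noncomputable section

open NumberField IsDedekindDomain MeasureTheory
open scoped Matrix ComplexOrder

open Literature.NumberTheory Literature.NumberTheory.Automorphic Literature.NumberTheory.Automorphic.UnitaryGroup
open Literature.NumberTheory.Automorphic.IdeleClassGroup
open Literature.NumberTheory.GaloisRepresentations
open Literature.NumberTheory.Rogawski1990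

namespace Summit.HodgeConjecture.HodgeConjecture.R90.S9

open Summit.HodgeConjecture.HodgeConjecture.Cruxes.H413
open Summit.HodgeConjecture.HodgeConjecture.Cruxes.H413.F0P3GlobalPacket Summit.HodgeConjecture.HodgeConjecture.Cruxes.H413.F0P3LocalPacketKit
open Summit.HodgeConjecture.HodgeConjecture.Cruxes.H413.F0P3XiPacketFamilyOfRecordSCD (xiPacketFamilyOfRecordSCD hSCD_of_cmCharIdentityPackageTestSigned
  hSCD_of_cmCharIdentityPackageTestSigned_fst)

open scoped Classical in
set_option synthInstance.maxHeartbeats 400000 in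
set_option maxHeartbeats 8000000 in
/-- **(δ5) `definiteAeRigidity_ofLevelPins` — (δ1) AT THE CONCRETE LEVEL DATUM, six pins + `hPis` discharged.**  = ★ `definiteAeRigidity_ofLevels` at `Λ := Level L`, `𝓕 := IsLevelTest …`, `E := Evp L H`, `Hk := HeckeOff L H`, `ev := evOff L H μv`, `U := EvpSupport L H μv`, `tR := gradeRep …`, `tP := gradePacket … X`, `tH := gradePacketH … X`, `tw′ := twistTest L H μv`, with `hUR hUP hUH h𝓕tw hliftEx hgerm` := R90-IF-p04's ★ pins and `hPis := pisSlotsNotSphericalCofinite_recordSCD …` (★ (δ4)).  Binders: the (S-G) instance prefix of ★ `definiteXiMembership_of_ch14`'s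
`hRig` (`L H hH hHd`, `hanis`, frames, `Δ mH mG νG νH`, `μω hμu hμω`, the SIGNED package `hQS`), the FRAME `(ι T hT)` and SCOPE `hsph : IsKcSpherical … P` of `Γ₀^{sph}`
(S9-R-Kc), `ξ μA P`, (AE) for `ξ` (BYTES of `hRig`'s clause), the record's V6 data `μZ keys`, the kit `𝔩` and the OWED bundle `X : DatumInputs …` of ★ `gammaSph`; then the LAW
BINDERS ONLY: (S6) `h51k` Thm. 14.5.1 (b) in kit shape over loose `(Smooth Transfer TransferH SθG SθH)` with `X.traceL` (J5); (S5∕S8) `PSVanish PSVanishH MatchH h62 h38 hexH hH61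
hvan hvanH` (the hypotheses of ★ `Ch14Bridge.thm1461_of_thm1451b_of_prop1362` at `X.G X.tr X.trH`; `hvan` over `Transfer₀ := Smooth ∧ Transfer`); (S7) `h64 : Γ₀.thm1461 Transfer₀
TransferH → Γ₀.sec146_evp ∧ Γ₀.sec146_partition ∧ Γ₀.thm1464a`; (S5) `Pξ : X.G.Packet`, `hA : X.G.IsAPacket Pξ`; (J9) `hevpXi : evp Ξ₀ 𝔩 (piXiPrime Ξ₀ ξ) (X.finOfG Pξ)`.
Conclusion = the (S-G) tail of `hRig` BYTE FOR BYTE.  Proof: ★ `definiteAeRigidityAt_of_parts'` with `π′ := classOfSph P hsph`, `hm := gammaSph_m'_ne_zero`, `hD := gammaSph_dSplit`,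
`hstring := aeString_of_ae`, `hevp := fun _ => evpRep_of_ae_of_evp_piXiPrime … hevpXi` (α2, `rfl` read-back), `hback := sgTail_of_ae_of_recordSCD …` (α1) after ★
`gammaSph_mem'_piXi'_classOfSph`, and `h51 := h51k` curried (SEAM 8).  No `sorry`; axioms `propext`, `Classical.choice`, `Quot.sound`.
[cite: Rogawski1990, §14.5 Thm. 14.5.1 (b) p. 238; §14.6 Thm. 14.6.1 p. 241, p. 242, Thm. 14.6.4 p. 244; §13.3 Thm. 13.3.5 p. 202; §13.1 Prop. 13.1.3 (d), Prop. 13.1.4 p. 199; §12.2 (2) p. 174] [cite: FlathCorvallis1979, Thm. 3] -/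
theorem definiteAeRigidity_ofLevelPins
    (L : Type) [Field L] [NumberField L] [IsCMField L] (H : Matrix (Fin 3) (Fin 3) L)
    (hH : (H.map (cmConjRingHom L))ᵀ = H) (hHd : IsUnit H.det)
    [∀ v : HeightOneSpectrum (𝓞 ↥(maximalRealSubfield L)), MeasurableSpace ((cmDatum L 3 H).Local v)]
    [∀ v : HeightOneSpectrum (𝓞 ↥(maximalRealSubfield L)),
      MeasurableSpace ((cmDatum L 2 (Matrix.of fun i j : Fin 2 => if i.val + j.val + 1 = 2 then (1 : L) else 0)).Local v ×
        (cmDatum L 1 (Matrix.of fun i j : Fin 1 => if i.val + j.val + 1 = 1 then (1 : L) else 0)).Local v)]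
    [∀ (v : HeightOneSpectrum (𝓞 ↥(maximalRealSubfield L)))
        (a : ((cmDatum L 2 (Matrix.of fun i j : Fin 2 => if i.val + j.val + 1 = 2 then (1 : L) else 0)).Local v ×
          (cmDatum L 1 (Matrix.of fun i j : Fin 1 => if i.val + j.val + 1 = 1 then (1 : L) else 0)).Local v)),
      MeasurableSpace (((cmDatum L 2 (Matrix.of fun i j : Fin 2 => if i.val + j.val + 1 = 2 then (1 : L) else 0)).Local v ×
          (cmDatum L 1 (Matrix.of fun i j : Fin 1 => if i.val + j.val + 1 = 1 then (1 : L) else 0)).Local v) ⧸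
        Subgroup.centralizer ({a} : Set ((cmDatum L 2 (Matrix.of fun i j : Fin 2 => if i.val + j.val + 1 = 2 then (1 : L) else 0)).Local v ×
          (cmDatum L 1 (Matrix.of fun i j : Fin 1 => if i.val + j.val + 1 = 1 then (1 : L) else 0)).Local v)))]
    [∀ (v : HeightOneSpectrum (𝓞 ↥(maximalRealSubfield L))) (γ : (cmDatum L 3 H).Local v),
      MeasurableSpace ((cmDatum L 3 H).Local v ⧸ Subgroup.centralizer ({γ} : Set ((cmDatum L 3 H).Local v)))]
    (Δ : ∀ v : HeightOneSpectrum (𝓞 ↥(maximalRealSubfield L)), LocalTransferFactor L H v)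
    (mH : ∀ v : HeightOneSpectrum (𝓞 ↥(maximalRealSubfield L)),
      OrbitalMeasureFamily ((cmDatum L 2 (Matrix.of fun i j : Fin 2 => if i.val + j.val + 1 = 2 then (1 : L) else 0)).Local v ×
        (cmDatum L 1 (Matrix.of fun i j : Fin 1 => if i.val + j.val + 1 = 1 then (1 : L) else 0)).Local v))
    (mG : ∀ v : HeightOneSpectrum (𝓞 ↥(maximalRealSubfield L)), OrbitalMeasureFamily ((cmDatum L 3 H).Local v))
    (νG : ∀ v : HeightOneSpectrum (𝓞 ↥(maximalRealSubfield L)), Measure ((cmDatum L 3 H).Local v))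
    (νH : ∀ v : HeightOneSpectrum (𝓞 ↥(maximalRealSubfield L)),
      Measure ((cmDatum L 2 (Matrix.of fun i j : Fin 2 => if i.val + j.val + 1 = 2 then (1 : L) else 0)).Local v ×
        (cmDatum L 1 (Matrix.of fun i j : Fin 1 => if i.val + j.val + 1 = 1 then (1 : L) else 0)).Local v))
    [∀ v : HeightOneSpectrum (𝓞 ↥(maximalRealSubfield L)), BorelSpace ((cmDatum L 3 H).Local v)]
    [∀ v : HeightOneSpectrum (𝓞 ↥(maximalRealSubfield L)),
      BorelSpace ((cmDatum L 2 (Matrix.of fun i j : Fin 2 => if i.val + j.val + 1 = 2 then (1 : L) else 0)).Local v ×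
        (cmDatum L 1 (Matrix.of fun i j : Fin 1 => if i.val + j.val + 1 = 1 then (1 : L) else 0)).Local v)]
    [∀ (v : HeightOneSpectrum (𝓞 ↥(maximalRealSubfield L)))
        (a : ((cmDatum L 2 (Matrix.of fun i j : Fin 2 => if i.val + j.val + 1 = 2 then (1 : L) else 0)).Local v ×
          (cmDatum L 1 (Matrix.of fun i j : Fin 1 => if i.val + j.val + 1 = 1 then (1 : L) else 0)).Local v)),
      BorelSpace (((cmDatum L 2 (Matrix.of fun i j : Fin 2 => if i.val + j.val + 1 = 2 then (1 : L) else 0)).Local v ×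
          (cmDatum L 1 (Matrix.of fun i j : Fin 1 => if i.val + j.val + 1 = 1 then (1 : L) else 0)).Local v) ⧸
        Subgroup.centralizer ({a} : Set ((cmDatum L 2 (Matrix.of fun i j : Fin 2 => if i.val + j.val + 1 = 2 then (1 : L) else 0)).Local v ×
          (cmDatum L 1 (Matrix.of fun i j : Fin 1 => if i.val + j.val + 1 = 1 then (1 : L) else 0)).Local v)))]
    [∀ (v : HeightOneSpectrum (𝓞 ↥(maximalRealSubfield L))) (γ : (cmDatum L 3 H).Local v),
      BorelSpace ((cmDatum L 3 H).Local v ⧸ Subgroup.centralizer ({γ} : Set ((cmDatum L 3 H).Local v)))]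
    [∀ v, (νG v).IsHaarMeasure] [∀ v, (νG v).IsMulRightInvariant] [∀ v, (νH v).IsHaarMeasure] [∀ v, (νH v).IsMulRightInvariant]
    (hanis : ∀ x : Fin 3 → L, Literature.AlgebraicGeometry.ShimuraVarieties.hermForm (cmConjRingHom L) H x x = 0 → x = 0)
    (μω : HeckeCharacter L) (hμu : μω.IsUnitary)
    (hμω : ∀ x : Literature.NumberTheory.GaloisRepresentations.ideleGroup ↥(maximalRealSubfield L),
      μω (AdeleRing.ideleBaseChange (↥(maximalRealSubfield L)) L x) = quadraticHeckeCharCM L x)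
    (hQS : CMCharIdentityPackageTestSigned L H hH hHd νH νG μω hμu Δ mH mG)
    -- THE FRAME of `Γ₀^{sph}` (S9-R-b′ ∕ consumer :703): `ᵗT̄ · H^ι · T = J`
    (ι : L →+* ℂ) (T : GL (Fin 3) ℂ)
    (hT : (T : Matrix (Fin 3) (Fin 3) ℂ)ᴴ * H.map ι * (T : Matrix (Fin 3) (Fin 3) ℂ) = Literature.Geometry.ComplexHyperbolic.BallModel.J)
    (ξ : OneDimAutRepH L)
    (μA : Measure (adelicGroupData (↥(maximalRealSubfield L)) L (IsCMField.complexConj L) 3 H).automorphicQuotient)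
    [(adelicGroupData (↥(maximalRealSubfield L)) L (IsCMField.complexConj L) 3 H).IsAutomorphicMeasure μA]
    (P : DiscreteAutomorphicRep (adelicGroupData (↥(maximalRealSubfield L)) L (IsCMField.complexConj L) 3 H) μA)
    -- THE SCOPE of `Γ₀^{sph}` (S9-R-Kc): `P_∞` is `K_c`-spherical
    (hsph : InnerFormSec146.IsKcSpherical L ι H T hT μA P)
    (hAE :
      (∃ S : Finset (HeightOneSpectrum (𝓞 ↥(maximalRealSubfield L))),
        (∀ v : HeightOneSpectrum (𝓞 ↥(maximalRealSubfield L)), v ∉ S →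
          ∀ (hns : ∀ w : PlacesOver L v, IsCMField.complexConj L • w.1 = w.1)
            (T : GL (Fin 3) (LocalRing L v)) (a : LocalRing L v) (ha : IsUnit a)
            (h : formCongr (conjLocal L (IsCMField.complexConj L) v) T (H.map (algebraMap L (LocalRing L v))) =
              a • (Matrix.of fun i j : Fin 3 => if i.val + j.val + 1 = 3 then (1 : L) else 0).map (algebraMap L (LocalRing L v))),
          ∀ [MeasurableSpace (Gqs L v ⧸ Subgroup.center (Gqs L v))] [BorelSpace (Gqs L v ⧸ Subgroup.center (Gqs L v))]
            (μZ : Measure (Gqs L v ⧸ Subgroup.center (Gqs L v))) [μZ.IsHaarMeasure],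
          ∀ (π2 πn : IrrClass (Gqs L v)),
            KeysCaseTwoLabels L v (μω.semilocalComponent L v) (torusLocalComponent L (IsCMField.complexConj L) v ξ.η)
              (torusLocalComponent L (IsCMField.complexConj L) v ξ.ψ) π2 πn →
            ¬ πn.IsSquareIntegrable μZ →
            ∀ c : IrrClass ((cmDatum L 3 H).Local v),
              (IrrClass.comap (localPiEquiv L (IsCMField.complexConj L) 3 H v) c).IsConstituentOf
                  (P.finRep.smoothPart.toRepresentation.comp (inclPlace (↥(maximalRealSubfield L)) L (IsCMField.complexConj L) 3 H v)) →
              c = IrrClass.comap (cmDatumLocalCongr L v T ha h).symm πn) ∧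
        (∀ v : HeightOneSpectrum (𝓞 ↥(maximalRealSubfield L)), v ∉ S →
          ∀ (hs : ∃ w : PlacesOver L v, IsCMField.complexConj L • w.1 ≠ w.1),
            ∀ c : IrrClass ((cmDatum L 3 H).Local v),
              (IrrClass.comap (localPiEquiv L (IsCMField.complexConj L) 3 H v) c).IsConstituentOf
                  (P.finRep.smoothPart.toRepresentation.comp (inclPlace (↥(maximalRealSubfield L)) L (IsCMField.complexConj L) 3 H v)) →
              c ∈ (cmSplitPacket L H hH hHd v (splitWitness v hs) (splitWitness_spec v hs) (ξ.splitν₀ μω (splitWitness v hs).1)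
                (ξ.locψ (splitWitness v hs).1) (ξ.norm_splitν₀_apply hμu (splitWitness v hs).1)
                (ξ.continuous_splitν₀ μω (splitWitness v hs).1) (ξ.norm_locψ_apply (splitWitness v hs).1)
                (ξ.continuous_locψ (splitWitness v hs).1)).members)))
    -- THE RECORD'S V6 DATA (rung-0 Borel Haar measures on the `U(Φ₃)(L⁺_v)⧸Z`, Keys' labelled pairs): fix `Ξ₀ := xiPacketFamilyOfRecordSCD … μZ keys (hSCD_…Signed … μZ hQS)`
    [∀ v : HeightOneSpectrum (𝓞 ↥(maximalRealSubfield L)), MeasurableSpace (Gqs L v ⧸ Subgroup.center (Gqs L v))]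
    [∀ v : HeightOneSpectrum (𝓞 ↥(maximalRealSubfield L)), BorelSpace (Gqs L v ⧸ Subgroup.center (Gqs L v))]
    (μZ : ∀ v : HeightOneSpectrum (𝓞 ↥(maximalRealSubfield L)), Measure (Gqs L v ⧸ Subgroup.center (Gqs L v)))
    [∀ v : HeightOneSpectrum (𝓞 ↥(maximalRealSubfield L)), (μZ v).IsHaarMeasure]
    (keys : ∀ (ξ : OneDimAutRepH L) (v : HeightOneSpectrum (𝓞 ↥(maximalRealSubfield L))),
      (∀ w : PlacesOver L v, IsCMField.complexConj L • w.1 = w.1) →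
        {p : IrrClass (Gqs L v) × IrrClass (Gqs L v) //
          KeysCaseTwoLabels L v (μω.semilocalComponent L v) (torusLocalComponent L (IsCMField.complexConj L) v ξ.η)
            (torusLocalComponent L (IsCMField.complexConj L) v ξ.ψ) p.1 p.2 ∧
          p.1.IsSquareIntegrable (μZ v) ∧ ¬ p.2.IsSquareIntegrable (μZ v)})
    -- THE KIT `𝔩` at which `G`'s packets are read, and the OWED bundle of ★ `gammaSph` (G-side `X.G := gOfRecord …`, traces, `X.traceL := ⇑𝔨.traceGp`, readers) over an arbitrary `G′`-test type
    {H' : Matrix (Fin 3) (Fin 3) L} (𝔩 : ∀ v : HeightOneSpectrum (𝓞 ↥(maximalRealSubfield L)), LocalPacketKit L H' v)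
    -- local Haar measures on the `U(H)(L⁺_v)` (Borel), for the gradings and the twist `f′ ↦ f′ ∗ h`
    (μv : ∀ v : HeightOneSpectrum (𝓞 ↥(maximalRealSubfield L)), @Measure ((cmDatum L 3 H).Local v) (borel _))
    (hμ : ∀ v, letI : MeasurableSpace ((cmDatum L 3 H).Local v) := borel _; (μv v).IsHaarMeasure)
    (X : InnerFormSec146.DatumInputs ((UnitaryGroup.arch (↥(maximalRealSubfield L)) L (IsCMField.complexConj L) 3 H → ℂ) ×
      (∀ v : HeightOneSpectrum (𝓞 ↥(maximalRealSubfield L)), (cmDatum L 3 H).Local v → ℂ))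
      (CompactlySupportedContinuousMap (cmDatum L 3 (Matrix.of fun i j : Fin 3 => if i.val + j.val + 1 = 3 then (1 : L) else 0)).Adelic ℂ)
      (CompactlySupportedContinuousMap ((cmDatum L 2 (Matrix.of fun i j : Fin 2 => if i.val + j.val + 1 = 2 then (1 : L) else 0)).Adelic × (cmDatum L 1 (Matrix.of fun i j : Fin 1 => if i.val + j.val + 1 = 1 then (1 : L) else 0)).Adelic) ℂ) L ι H T hT μA
      (xiPacketFamilyOfRecordSCD L H hH hHd μω hμu μZ keys (hSCD_of_cmCharIdentityPackageTestSigned L H hH hHd μω hμu Δ mH mG νG νH μZ hQS)) 𝔩)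
    -- (S6) Thm. 14.5.1 (b) IN THE S6-B KIT SHAPE over loose `(Smooth, Transfer, TransferH, SθG, SθH)` (B: `𝔨.Smooth`, `IsKcBiInv ∧ 𝔨.Transfer`, `𝔨.TransferH`, `𝔨.SJGtot`, `𝔨.SJHtot`; J5)
    (Smooth : ((UnitaryGroup.arch (↥(maximalRealSubfield L)) L (IsCMField.complexConj L) 3 H → ℂ) ×
      (∀ v : HeightOneSpectrum (𝓞 ↥(maximalRealSubfield L)), (cmDatum L 3 H).Local v → ℂ)) → Prop)
    (Transfer : ((UnitaryGroup.arch (↥(maximalRealSubfield L)) L (IsCMField.complexConj L) 3 H → ℂ) ×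
      (∀ v : HeightOneSpectrum (𝓞 ↥(maximalRealSubfield L)), (cmDatum L 3 H).Local v → ℂ)) → (CompactlySupportedContinuousMap (cmDatum L 3 (Matrix.of fun i j : Fin 3 => if i.val + j.val + 1 = 3 then (1 : L) else 0)).Adelic ℂ) → Prop)
    (TransferH : ((UnitaryGroup.arch (↥(maximalRealSubfield L)) L (IsCMField.complexConj L) 3 H → ℂ) ×
      (∀ v : HeightOneSpectrum (𝓞 ↥(maximalRealSubfield L)), (cmDatum L 3 H).Local v → ℂ)) → (CompactlySupportedContinuousMap ((cmDatum L 2 (Matrix.of fun i j : Fin 2 => if i.val + j.val + 1 = 2 then (1 : L) else 0)).Adelic × (cmDatum L 1 (Matrix.of fun i j : Fin 1 => if i.val + j.val + 1 = 1 then (1 : L) else 0)).Adelic) ℂ) → Prop)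
    (SθG : (CompactlySupportedContinuousMap (cmDatum L 3 (Matrix.of fun i j : Fin 3 => if i.val + j.val + 1 = 3 then (1 : L) else 0)).Adelic ℂ) → ℂ)
    (SθH : (CompactlySupportedContinuousMap ((cmDatum L 2 (Matrix.of fun i j : Fin 2 => if i.val + j.val + 1 = 2 then (1 : L) else 0)).Adelic × (cmDatum L 1 (Matrix.of fun i j : Fin 1 => if i.val + j.val + 1 = 1 then (1 : L) else 0)).Adelic) ℂ) → ℂ)
    (h51k : ∀ (f' : ((UnitaryGroup.arch (↥(maximalRealSubfield L)) L (IsCMField.complexConj L) 3 H → ℂ) ×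
      (∀ v : HeightOneSpectrum (𝓞 ↥(maximalRealSubfield L)), (cmDatum L 3 H).Local v → ℂ)))
      (f : (CompactlySupportedContinuousMap (cmDatum L 3 (Matrix.of fun i j : Fin 3 => if i.val + j.val + 1 = 3 then (1 : L) else 0)).Adelic ℂ))
      (fH : (CompactlySupportedContinuousMap ((cmDatum L 2 (Matrix.of fun i j : Fin 2 => if i.val + j.val + 1 = 2 then (1 : L) else 0)).Adelic × (cmDatum L 1 (Matrix.of fun i j : Fin 1 => if i.val + j.val + 1 = 1 then (1 : L) else 0)).Adelic) ℂ)),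
      Smooth f' → Transfer f' f ∧ TransferH f' fH → X.traceL f' = SθG f + (1 / 2 : ℂ) * SθH fH)
    -- (S5 ∕ S8) the ★ `GlobalPacketData` discrete expansions + vanishing classes at `X.G`, `X.tr`, `X.trH` (J8)
    (PSVanish : (CompactlySupportedContinuousMap (cmDatum L 3 (Matrix.of fun i j : Fin 3 => if i.val + j.val + 1 = 3 then (1 : L) else 0)).Adelic ℂ) → Prop)
    (PSVanishH : (CompactlySupportedContinuousMap ((cmDatum L 2 (Matrix.of fun i j : Fin 2 => if i.val + j.val + 1 = 2 then (1 : L) else 0)).Adelic × (cmDatum L 1 (Matrix.of fun i j : Fin 1 => if i.val + j.val + 1 = 1 then (1 : L) else 0)).Adelic) ℂ) → Prop)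
    (MatchH : (CompactlySupportedContinuousMap (cmDatum L 3 (Matrix.of fun i j : Fin 3 => if i.val + j.val + 1 = 3 then (1 : L) else 0)).Adelic ℂ) →
      (CompactlySupportedContinuousMap ((cmDatum L 2 (Matrix.of fun i j : Fin 2 => if i.val + j.val + 1 = 2 then (1 : L) else 0)).Adelic × (cmDatum L 1 (Matrix.of fun i j : Fin 1 => if i.val + j.val + 1 = 1 then (1 : L) else 0)).Adelic) ℂ) → Prop)
    (h62 : X.G.DiscreteMinusEndoscopicExpansionG X.tr X.trH SθG PSVanish PSVanishH MatchH)
    (h38 : X.G.Thm1338Packetwise X.tr X.trH MatchH)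
    (hexH : ∀ f, PSVanish f → ∃ fH, PSVanishH fH ∧ MatchH f fH)
    (hH61 : X.G.StableDiscreteExpansionH X.trH SθH PSVanishH)
    (hvan : ∀ (f' : ((UnitaryGroup.arch (↥(maximalRealSubfield L)) L (IsCMField.complexConj L) 3 H → ℂ) ×
      (∀ v : HeightOneSpectrum (𝓞 ↥(maximalRealSubfield L)), (cmDatum L 3 H).Local v → ℂ)))
      (f : (CompactlySupportedContinuousMap (cmDatum L 3 (Matrix.of fun i j : Fin 3 => if i.val + j.val + 1 = 3 then (1 : L) else 0)).Adelic ℂ)), Smooth f' ∧ Transfer f' f → PSVanish f)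
    (hvanH : ∀ (f' : ((UnitaryGroup.arch (↥(maximalRealSubfield L)) L (IsCMField.complexConj L) 3 H → ℂ) ×
      (∀ v : HeightOneSpectrum (𝓞 ↥(maximalRealSubfield L)), (cmDatum L 3 H).Local v → ℂ)))
      (fH : (CompactlySupportedContinuousMap ((cmDatum L 2 (Matrix.of fun i j : Fin 2 => if i.val + j.val + 1 = 2 then (1 : L) else 0)).Adelic × (cmDatum L 1 (Matrix.of fun i j : Fin 1 => if i.val + j.val + 1 = 1 then (1 : L) else 0)).Adelic) ℂ)), TransferH f' fH → PSVanishH fH)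
    -- (E1 ∕ S10) THE CONCRETE LEVEL DATUM (★ R90-IF-p04 (g2) `Levels`∕`LevelPins`): the residual hypotheses of ★ `hsep_gammaSph_of_levelPins` (χ-expansion on level tests, FL for the
    -- consumer's Hecke twists `tw twH`, eigen-laws, Langlands' lemma, the graded cover with a guarded detector) + the two (E)-pins of ★ `h1335_of_levels` (`hgermLevel`, `htP`)
    (hχ𝓕 : ∀ (l : InnerFormSec146.Level L) (f' : ((UnitaryGroup.arch (↥(maximalRealSubfield L)) L (IsCMField.complexConj L) 3 H → ℂ) ×
      (∀ v : HeightOneSpectrum (𝓞 ↥(maximalRealSubfield L)), (cmDatum L 3 H).Local v → ℂ))),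
      InnerFormSec146.IsLevelTest L ι H T hT l f' →
        Summable (fun π' : (InnerFormSec146.RepPrimeSph L ι H T hT μA) => (InnerFormSec146.mPrimeSph L ι H T hT μA π' : ℂ) * X.trPrime π' f') ∧
          X.traceL f' = ∑' π' : (InnerFormSec146.RepPrimeSph L ι H T hT μA), (InnerFormSec146.mPrimeSph L ι H T hT μA π' : ℂ) * X.trPrime π' f')
    (tw : ∀ l : InnerFormSec146.Level L, InnerFormSec146.HeckeOff L H l → (CompactlySupportedContinuousMap (cmDatum L 3 (Matrix.of fun i j : Fin 3 => if i.val + j.val + 1 = 3 then (1 : L) else 0)).Adelic ℂ) → (CompactlySupportedContinuousMap (cmDatum L 3 (Matrix.of fun i j : Fin 3 => if i.val + j.val + 1 = 3 then (1 : L) else 0)).Adelic ℂ))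
    (twH : ∀ l : InnerFormSec146.Level L, InnerFormSec146.HeckeOff L H l →
      (CompactlySupportedContinuousMap ((cmDatum L 2 (Matrix.of fun i j : Fin 2 => if i.val + j.val + 1 = 2 then (1 : L) else 0)).Adelic × (cmDatum L 1 (Matrix.of fun i j : Fin 1 => if i.val + j.val + 1 = 1 then (1 : L) else 0)).Adelic) ℂ) →
      (CompactlySupportedContinuousMap ((cmDatum L 2 (Matrix.of fun i j : Fin 2 => if i.val + j.val + 1 = 2 then (1 : L) else 0)).Adelic × (cmDatum L 1 (Matrix.of fun i j : Fin 1 => if i.val + j.val + 1 = 1 then (1 : L) else 0)).Adelic) ℂ))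
    (hTw : ∀ (l : InnerFormSec146.Level L) (h : InnerFormSec146.HeckeOff L H l) (f' : ((UnitaryGroup.arch (↥(maximalRealSubfield L)) L (IsCMField.complexConj L) 3 H → ℂ) ×
      (∀ v : HeightOneSpectrum (𝓞 ↥(maximalRealSubfield L)), (cmDatum L 3 H).Local v → ℂ)))
      (f : (CompactlySupportedContinuousMap (cmDatum L 3 (Matrix.of fun i j : Fin 3 => if i.val + j.val + 1 = 3 then (1 : L) else 0)).Adelic ℂ)),
      InnerFormSec146.IsLevelTest L ι H T hT l f' → (Smooth f' ∧ Transfer f' f) →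
        (Smooth (InnerFormSec146.twistTest L H μv l h f') ∧ Transfer (InnerFormSec146.twistTest L H μv l h f') (tw l h f)))
    (hTHw : ∀ (l : InnerFormSec146.Level L) (h : InnerFormSec146.HeckeOff L H l) (f' : ((UnitaryGroup.arch (↥(maximalRealSubfield L)) L (IsCMField.complexConj L) 3 H → ℂ) ×
      (∀ v : HeightOneSpectrum (𝓞 ↥(maximalRealSubfield L)), (cmDatum L 3 H).Local v → ℂ)))
      (fH : (CompactlySupportedContinuousMap ((cmDatum L 2 (Matrix.of fun i j : Fin 2 => if i.val + j.val + 1 = 2 then (1 : L) else 0)).Adelic × (cmDatum L 1 (Matrix.of fun i j : Fin 1 => if i.val + j.val + 1 = 1 then (1 : L) else 0)).Adelic) ℂ)),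
      InnerFormSec146.IsLevelTest L ι H T hT l f' → TransferH f' fH → TransferH (InnerFormSec146.twistTest L H μv l h f') (twH l h fH))
    (hER : ∀ (l : InnerFormSec146.Level L) (h : InnerFormSec146.HeckeOff L H l) (f' : ((UnitaryGroup.arch (↥(maximalRealSubfield L)) L (IsCMField.complexConj L) 3 H → ℂ) ×
      (∀ v : HeightOneSpectrum (𝓞 ↥(maximalRealSubfield L)), (cmDatum L 3 H).Local v → ℂ))),
      InnerFormSec146.IsLevelTest L ι H T hT l f' → ∀ π' : (InnerFormSec146.RepPrimeSph L ι H T hT μA),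
        X.trPrime π' (InnerFormSec146.twistTest L H μv l h f') =
          ((InnerFormSec146.gradeRep L ι H T hT μA μv l π').elim 0 fun e => InnerFormSec146.evOff L H μv l e h) * X.trPrime π' f')
    (hEP : ∀ (l : InnerFormSec146.Level L) (h : InnerFormSec146.HeckeOff L H l) (f' : ((UnitaryGroup.arch (↥(maximalRealSubfield L)) L (IsCMField.complexConj L) 3 H → ℂ) ×
      (∀ v : HeightOneSpectrum (𝓞 ↥(maximalRealSubfield L)), (cmDatum L 3 H).Local v → ℂ)))
      (f : (CompactlySupportedContinuousMap (cmDatum L 3 (Matrix.of fun i j : Fin 3 => if i.val + j.val + 1 = 3 then (1 : L) else 0)).Adelic ℂ)),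
      InnerFormSec146.IsLevelTest L ι H T hT l f' → (Smooth f' ∧ Transfer f' f) → ∀ P : X.G.Packet,
        X.G.packetTrace X.tr P (tw l h f) =
          ((InnerFormSec146.gradePacket _ _ _ L ι H T hT μA μv (xiPacketFamilyOfRecordSCD L H hH hHd μω hμu μZ keys (hSCD_of_cmCharIdentityPackageTestSigned L H hH hHd μω hμu Δ mH mG νG νH μZ hQS)) 𝔩 X l P).elim 0
            fun e => InnerFormSec146.evOff L H μv l e h) * X.G.packetTrace X.tr P f)
    (hEH : ∀ (l : InnerFormSec146.Level L) (h : InnerFormSec146.HeckeOff L H l) (f' : ((UnitaryGroup.arch (↥(maximalRealSubfield L)) L (IsCMField.complexConj L) 3 H → ℂ) ×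
      (∀ v : HeightOneSpectrum (𝓞 ↥(maximalRealSubfield L)), (cmDatum L 3 H).Local v → ℂ)))
      (fH : (CompactlySupportedContinuousMap ((cmDatum L 2 (Matrix.of fun i j : Fin 2 => if i.val + j.val + 1 = 2 then (1 : L) else 0)).Adelic × (cmDatum L 1 (Matrix.of fun i j : Fin 1 => if i.val + j.val + 1 = 1 then (1 : L) else 0)).Adelic) ℂ)),
      InnerFormSec146.IsLevelTest L ι H T hT l f' → TransferH f' fH → ∀ ρ : X.G.PacketH,
        X.trH ρ (twH l h fH) =
          ((InnerFormSec146.gradePacketH _ _ _ L ι H T hT μA μv (xiPacketFamilyOfRecordSCD L H hH hHd μω hμu μZ keys (hSCD_of_cmCharIdentityPackageTestSigned L H hH hHd μω hμu Δ mH mG νG νH μZ hQS)) 𝔩 X l ρ).elim 0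
            fun e => InnerFormSec146.evOff L H μv l e h) * X.trH ρ fH)
    (hsepL : ∀ l : InnerFormSec146.Level L,
      IsCountablyLinIndepOn (InnerFormSec146.EvpSupport L H μv l) (fun _ : InnerFormSec146.HeckeOff L H l => True) (InnerFormSec146.evOff L H μv l))
    (hcoverR : ∀ π' : (InnerFormSec146.RepPrimeSph L ι H T hT μA), InnerFormSec146.mPrimeSph L ι H T hT μA π' ≠ 0 →
      ∃ (l : InnerFormSec146.Level L) (e : InnerFormSec146.Evp L H) (f₀ : ((UnitaryGroup.arch (↥(maximalRealSubfield L)) L (IsCMField.complexConj L) 3 H → ℂ) ×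
      (∀ v : HeightOneSpectrum (𝓞 ↥(maximalRealSubfield L)), (cmDatum L 3 H).Local v → ℂ)))
        (f : (CompactlySupportedContinuousMap (cmDatum L 3 (Matrix.of fun i j : Fin 3 => if i.val + j.val + 1 = 3 then (1 : L) else 0)).Adelic ℂ))
        (fH : (CompactlySupportedContinuousMap ((cmDatum L 2 (Matrix.of fun i j : Fin 2 => if i.val + j.val + 1 = 2 then (1 : L) else 0)).Adelic × (cmDatum L 1 (Matrix.of fun i j : Fin 1 => if i.val + j.val + 1 = 1 then (1 : L) else 0)).Adelic) ℂ)),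
        InnerFormSec146.gradeRep L ι H T hT μA μv l π' = some e ∧ InnerFormSec146.IsLevelTest L ι H T hT l f₀ ∧ (Smooth f₀ ∧ Transfer f₀ f) ∧ TransferH f₀ fH ∧
          (∀ π : (InnerFormSec146.RepPrimeSph L ι H T hT μA), 0 ≤ (InnerFormSec146.mPrimeSph L ι H T hT μA π : ℂ) * X.trPrime π f₀) ∧ (InnerFormSec146.mPrimeSph L ι H T hT μA π' : ℂ) * X.trPrime π' f₀ ≠ 0)
    (hgermLevel : ∀ (π' : (InnerFormSec146.RepPrimeSph L ι H T hT μA)) (P Q : X.G.Packet),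
      InnerFormSec146.evpRep L H μA 𝔩 π'.1 (X.finOfG P) → InnerFormSec146.evpRep L H μA 𝔩 π'.1 (X.finOfG Q) →
        ∃ (l : InnerFormSec146.Level L) (e : InnerFormSec146.Evp L H),
          InnerFormSec146.gradePacket _ _ _ L ι H T hT μA μv (xiPacketFamilyOfRecordSCD L H hH hHd μω hμu μZ keys (hSCD_of_cmCharIdentityPackageTestSigned L H hH hHd μω hμu Δ mH mG νG νH μZ hQS)) 𝔩 X l P = some e ∧
          InnerFormSec146.gradePacket _ _ _ L ι H T hT μA μv (xiPacketFamilyOfRecordSCD L H hH hHd μω hμu μZ keys (hSCD_of_cmCharIdentityPackageTestSigned L H hH hHd μω hμu Δ mH mG νG νH μZ hQS)) 𝔩 X l Q = some e)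
    (htP : ∀ (l : InnerFormSec146.Level L) (P Q : X.G.Packet) (e : InnerFormSec146.Evp L H),
      InnerFormSec146.gradePacket _ _ _ L ι H T hT μA μv (xiPacketFamilyOfRecordSCD L H hH hHd μω hμu μZ keys (hSCD_of_cmCharIdentityPackageTestSigned L H hH hHd μω hμu Δ mH mG νG νH μZ hQS)) 𝔩 X l P = some e →
      InnerFormSec146.gradePacket _ _ _ L ι H T hT μA μv (xiPacketFamilyOfRecordSCD L H hH hHd μω hμu μZ keys (hSCD_of_cmCharIdentityPackageTestSigned L H hH hHd μω hμu Δ mH mG νG νH μZ hQS)) 𝔩 X l Q = some e → P = Q)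
    -- THE DATUM LAW «in at most one» for the A-packets of record `Ξ₀` [p. 199 l. 17] (S3∕S4); «`πˢ(ξ_v)` ramified a.e.» is PAID (★ (δ4))
    (hDisj : ∀ v : HeightOneSpectrum (𝓞 ↥(maximalRealSubfield L)), InnerFormSec146.APacketsOfRecordDisjointAt L H (xiPacketFamilyOfRecordSCD L H hH hHd μω hμu μZ keys (hSCD_of_cmCharIdentityPackageTestSigned L H hH hHd μω hμu Δ mH mG νG νH μZ hQS)) v)
    -- (S5) the trichotomy of `Π(G)` [Thm. 13.3.5], `Π_a(G) = {Π(ξ)}`; (S2) `m_v n_v ≠ 0` on `S₀`; (S7) the re-cut (CMP) binder `hcoeffMem` at `Γ₀`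
    (htri : X.G.PacketTrichotomy)
    (hApkt : ∀ P : X.G.Packet, X.G.IsAPacket P → ∃ ξ : X.G.PacketH, X.IsOneDimH ξ ∧ X.G.liftsTo ξ P)
    (hmn : InnerFormSec146.DSplit L H → ∀ (P : X.G.Packet) (ξ : X.G.PacketH), X.G.IsAPacket P → X.IsOneDimH ξ → X.G.liftsTo ξ P →
      (∃ π' : (InnerFormSec146.RepPrimeSph L ι H T hT μA), InnerFormSec146.mPrimeSph L ι H T hT μA π' ≠ 0 ∧ InnerFormSec146.evpRep L H μA 𝔩 π'.1 (X.finOfG P)) →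
        ∀ v : InnerFormSec146.Place L, v ∈ InnerFormSec146.S0 L H → X.MnNeZero ξ v)
    (hcoeffMem : InnerFormSec146.DSplit L H → ∀ (P : X.G.Packet) (ξ : X.G.PacketH) (h₁ : X.IsOneDimH ξ)
      (hS : ∀ v : InnerFormSec146.Place L, v ∈ InnerFormSec146.S0 L H → X.MnNeZero ξ v),
      X.G.IsAPacket P → X.G.liftsTo ξ P → ∀ π' : (InnerFormSec146.RepPrimeSph L ι H T hT μA), InnerFormSec146.evpRep L H μA 𝔩 π'.1 (X.finOfG P) →
        InnerFormSec146.mPrimeSph L ι H T hT μA π' ≠ 0 →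
          InnerFormSec146.memPrime L H μA (xiPacketFamilyOfRecordSCD L H hH hHd μω hμu μZ keys (hSCD_of_cmCharIdentityPackageTestSigned L H hH hHd μω hμu Δ mH mG νG νH μZ hQS)) π'.1
            (InnerFormSec146.piXiPrime L H μA (xiPacketFamilyOfRecordSCD L H hH hHd μω hμu μZ keys (hSCD_of_cmCharIdentityPackageTestSigned L H hH hHd μω hμu Δ mH mG νG νH μZ hQS)) (X.oneDimOf ξ h₁)))
    -- (S5) the packet `Π(ξ)` OF RECORD on the `G`-side and «`Π(ξ) ∈ Π_a(G)`»; (J9) «`t(Π′(ξ)) = t(Π(ξ))`» read at the kit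
    (Pξ : X.G.Packet) (hA : X.G.IsAPacket Pξ)
    (hevpXi : InnerFormSec146.evp L H μA (xiPacketFamilyOfRecordSCD L H hH hHd μω hμu μZ keys (hSCD_of_cmCharIdentityPackageTestSigned L H hH hHd μω hμu Δ mH mG νG νH μZ hQS)) 𝔩
      (InnerFormSec146.piXiPrime L H μA (xiPacketFamilyOfRecordSCD L H hH hHd μω hμu μZ keys (hSCD_of_cmCharIdentityPackageTestSigned L H hH hHd μω hμu Δ mH mG νG νH μZ hQS)) ξ) (X.finOfG Pξ)) :
      ∀ (v : HeightOneSpectrum (𝓞 ↥(maximalRealSubfield L))) (hns : ∀ w : PlacesOver L v, IsCMField.complexConj L • w.1 = w.1),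
      ∀ (T : GL (Fin 3) (LocalRing L v)) (a : LocalRing L v) (ha : IsUnit a)
        (h : formCongr (conjLocal L (IsCMField.complexConj L) v) T (H.map (algebraMap L (LocalRing L v))) =
          a • (Matrix.of fun i j : Fin 3 => if i.val + j.val + 1 = 3 then (1 : L) else 0).map (algebraMap L (LocalRing L v))),
      ∀ [MeasurableSpace (Gqs L v ⧸ Subgroup.center (Gqs L v))] [BorelSpace (Gqs L v ⧸ Subgroup.center (Gqs L v))]
        (μZ : Measure (Gqs L v ⧸ Subgroup.center (Gqs L v))) [μZ.IsHaarMeasure],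
      ∀ (π2 πn : IrrClass (Gqs L v)),
      ∀ (hK : KeysCaseTwoLabels L v (μω.semilocalComponent L v) (torusLocalComponent L (IsCMField.complexConj L) v ξ.η)
          (torusLocalComponent L (IsCMField.complexConj L) v ξ.ψ) π2 πn)
        (hn : ¬ πn.IsSquareIntegrable μZ),
        -- (S-G) «13.3.6 (c) ∕ §14.6 AT PRINT'S PINNED DATA»: every v-constituent of P is πⁿ ∘ e, π² ∘ e, or the πˢ(ξ_v) ∘ e of `hQS`
        ∀ c : IrrClass ((cmDatum L 3 H).Local v),
          (IrrClass.comap (localPiEquiv L (IsCMField.complexConj L) 3 H v) c).IsConstituentOf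
              (P.finRep.smoothPart.toRepresentation.comp (inclPlace (↥(maximalRealSubfield L)) L (IsCMField.complexConj L) 3 H v)) →
          c = IrrClass.comap (cmDatumLocalCongr L v T ha h).symm πn ∨
            c = IrrClass.comap (cmDatumLocalCongr L v T ha h).symm π2 ∨
            c = ((hQS ξ).1 v hns T a ha h μZ π2 πn hK hn).πs := by
  haveI : ∀ v, (letI : MeasurableSpace ((cmDatum L 3 H).Local v) := borel _; (μv v).IsMulLeftInvariant) :=
    fun v => letI : MeasurableSpace ((cmDatum L 3 H).Local v) := borel _; (hμ v).toIsMulLeftInvariant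
  exact definiteAeRigidity_ofLevels L H hH hHd Δ mH mG νG νH hanis μω hμu hμω hQS ι T hT ξ μA P hsph hAE μZ keys 𝔩 X Smooth Transfer TransferH SθG SθH h51k
    PSVanish PSVanishH MatchH h62 h38 hexH hH61 hvan hvanH
    -- THE CONCRETE LEVEL DATUM (p04 (g2)): `Λ := Level`, `𝓕 := IsLevelTest`, `E := Evp`, `Hk := HeckeOff`, `ev := evOff`, `U := EvpSupport`, gradings, `tw′ := twistTest`
    (InnerFormSec146.IsLevelTest L ι H T hT) hχ𝓕 (fun l => InnerFormSec146.evOff L H μv l) (fun l => InnerFormSec146.EvpSupport L H μv l)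
    (fun l => InnerFormSec146.gradeRep L ι H T hT μA μv l)
    (fun l => InnerFormSec146.gradePacket _ _ _ L ι H T hT μA μv _ 𝔩 X l)
    (fun l => InnerFormSec146.gradePacketH _ _ _ L ι H T hT μA μv _ 𝔩 X l)
    (fun l π' e h => InnerFormSec146.gradeRep_mem_evpSupport L ι H T hT μA μv l π' e h)
    (fun l P e h => InnerFormSec146.gradePacket_mem_evpSupport _ _ L ι H T hT μA μv _ 𝔩 X l P e h)
    (fun l ρ e h => InnerFormSec146.gradePacketH_mem_evpSupport _ _ L ι H T hT μA μv _ 𝔩 X l ρ e h)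
    (fun l => InnerFormSec146.twistTest L H μv l) tw twH
    (fun l h f' hf' => InnerFormSec146.isLevelTest_twistTest L ι H T hT μv (fun v => this v) l h f' hf')
    hTw hTHw hER hEP hEH hsepL
    (fun l ρ e h => InnerFormSec146.exists_gradePacket_of_gradePacketH _ _ _ L ι H T hT μA μv _ 𝔩 X l ρ e h)
    hcoverR
    (fun l π' P e hP hπ => InnerFormSec146.evpRep_gammaSph_of_grade_eq _ _ L ι H T hT μA μv _ 𝔩 X hμ l π' P e hP hπ)
    hgermLevel htP hDisj
    (pisSlotsNotSphericalCofinite_recordSCD L H hH hHd μω hμu μZ keys _)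
    htri hApkt hmn hcoeffMem Pξ hA hevpXi

end Summit.HodgeConjecture.HodgeConjecture.R90.S9

end
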